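import Summits.RiemannHypothesis.RiemannHypothesis.Theorems.IntegerScrewCensusDualCellOK

/-!
# Route `IntegerScrew` — kernel checker for the census DUAL certificates (15): SOUNDNESS

`dualLight … = true` and `dualCheckW n lo D EB fuel 0 ⌈lo/4⌉ … = true` (plus the log table, the u-table, the
`ζ(2,¼)` bracket and the `225U ≤ 1` size check) give a dual certificate `DualCert n (1/10) lo (Zmat n Z)` and hence
`¬ ManifestCert n (1/10) lo` (`IntegerScrew.Manifest.dualCert_sound`).  The cells `[4c, 4c+4]` cover `[1/10, lo]`
(`cover`).  RH-free; nothing here bears on the truth of RH.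
-/

set_option linter.dupNamespace false
set_option autoImplicit false

namespace Summit.RiemannHypothesis.RiemannHypothesis.Theorems.IntegerScrew.Manifest.Fast

open Finset
open Literature.Analysis.ValidatedNumerics Literature.Analysis.ValidatedNumerics.Numerics

/-- Unrolling `cellsGoW`: every cell in the range passes with its rows flag. -/
theorem cellsGoW_spec (D E n lo Wm fuel : ℕ) (logs : List FI) (nds : List NodeD) (c0K : ℤ) (C1N sumA Lam : ℕ) :
    ∀ (k c : ℕ), cellsGoW D E n lo Wm fuel logs nds c0K C1N sumA Lam k c = true → ∀ c', c ≤ c' → c' < c + k →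
      (rows tcList logs 500 [2000 * c' + 1000] n).2 = true ∧
      cellCheck D (halfPack D) nds c0K (slacksW D E (32 * (2000 * c' + 1000) * Wm + 7000) C1N sumA Wm) Lam
        (((rows tcList logs 500 [2000 * c' + 1000] n).1.drop 2).map fun dr => dr.2.getD 0 (0, 0))
        (if c' = 0 then MR / 40 else 0) (if 4 * c' + 4 ≤ lo then MR else MR * (lo - 4 * c') / 4) fuel = true
  | 0, _, _, _, _, _ => by omega
  | k + 1, c, h, c', h1, h2 => by
    simp only [cellsGoW, Bool.and_eq_true] at h
    obtain ⟨⟨hR, hC⟩, hrest⟩ := h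
    rcases Nat.eq_or_lt_of_le h1 with rfl | hlt
    · exact ⟨hR, hC⟩
    · exact cellsGoW_spec D E n lo Wm fuel logs nds c0K C1N sumA Lam k (c + 1) hrest c' hlt (by omega)

/-- Concatenating two runs of cells. -/
theorem cellsGoW_append (D E n lo Wm fuel : ℕ) (logs : List FI) (nds : List NodeD) (c0K : ℤ) (C1N sumA Lam : ℕ) :
    ∀ (k1 k2 c : ℕ), cellsGoW D E n lo Wm fuel logs nds c0K C1N sumA Lam k1 c = true →
      cellsGoW D E n lo Wm fuel logs nds c0K C1N sumA Lam k2 (c + k1) = true →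
      cellsGoW D E n lo Wm fuel logs nds c0K C1N sumA Lam (k1 + k2) c = true
  | 0, k2, c, _, h2 => by simpa using h2
  | k1 + 1, k2, c, h1, h2 => by
    rw [Nat.add_right_comm]
    simp only [cellsGoW, Bool.and_eq_true] at h1 ⊢
    exact ⟨h1.1, cellsGoW_append D E n lo Wm fuel logs nds c0K C1N sumA Lam k1 k2 (c + 1) h1.2
      (by rw [show c + 1 + k1 = c + (k1 + 1) by omega]; exact h2)⟩

/-- **Splitting the heavy check into cell ranges**: `[a,b)` and `[b,c)` give `[a,c)`. -/
theorem dualCheckW_join {n lo D E fuel a b c : ℕ} {logs : List FI} {pats : List (ℕ × ℕ × ℕ)} {epsN : ℕ}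
    (hab : a ≤ b) (hbc : b ≤ c) (h1 : dualCheckW n lo D E fuel a b logs pats epsN = true)
    (h2 : dualCheckW n lo D E fuel b c logs pats epsN = true) : dualCheckW n lo D E fuel a c logs pats epsN = true := by
  unfold dualCheckW at h1 h2 ⊢
  have h := cellsGoW_append _ _ _ _ _ _ _ _ _ _ _ _ (b - a) (c - b) a h1 (by rw [Nat.add_sub_cancel' hab]; exact h2)
  rwa [show b - a + (c - b) = c - a by omega] at h

/-- **The cells cover `[1/10, lo]`**: every `t` there is `4c + 4τ` for a cell `c < ⌈lo/4⌉` and `τ` in the cell's range. -/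
theorem cover {lo : ℕ} (hlo : 1 ≤ lo) {t : ℝ} (ht1 : 1 / 10 ≤ t) (ht2 : t ≤ lo) :
    ∃ c : ℕ, c < (lo + 3) / 4 ∧
      (((if c = 0 then MR / 40 else 0 : ℕ)) : ℝ) / MR ≤ t / 4 - c ∧
        t / 4 - c ≤ (((if 4 * c + 4 ≤ lo then MR else MR * (lo - 4 * c) / 4 : ℕ)) : ℝ) / MR := by
  set N := (lo + 3) / 4 with hN
  have hN1 : 1 ≤ N := by omega
  have h4N : lo ≤ 4 * N := by omega
  have hMR : (MR : ℝ) = 1048576 := by norm_num [MR]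
  have h40 : (((MR / 40 : ℕ)) : ℝ) = 26214 := by norm_num [MR]
  have hmend : ∀ c, 4 * c ≤ lo → (((MR * (lo - 4 * c) / 4 : ℕ)) : ℝ) = 262144 * ((lo : ℝ) - 4 * c) := by
    intro c hc
    have : MR * (lo - 4 * c) / 4 = 262144 * (lo - 4 * c) := by norm_num [MR]; omega
    rw [this]; push_cast [Nat.cast_sub hc]; ring
  have ht0 : 0 ≤ t / 4 := by linarith
  set c0 := ⌊t / 4⌋₊ with hc0
  have hc0le : (c0 : ℝ) ≤ t / 4 := Nat.floor_le ht0
  have hc0lt : t / 4 < (c0 : ℝ) + 1 := Nat.lt_floor_add_one _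
  by_cases hcase : c0 + 1 ≤ N
  · refine ⟨c0, by omega, ?_, ?_⟩
    · split_ifs with h0
      · rw [h0, h40, hMR]; push_cast; linarith
      · rw [Nat.cast_zero, zero_div]; linarith
    · split_ifs with h4
      · rw [div_self (by rw [hMR]; norm_num)]; linarith
      · have hc4 : 4 * c0 ≤ lo := by
          have : (4 : ℝ) * c0 ≤ lo := by linarith
          exact_mod_cast this
        rw [hmend c0 hc4, hMR]
        rw [le_div_iff₀ (by norm_num)]
        nlinarith
  · have hcN : N ≤ c0 := by omega
    refine ⟨N - 1, by omega, ?_, ?_⟩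
    · have hN' : ((N - 1 : ℕ) : ℝ) = (N : ℝ) - 1 := by rw [Nat.cast_sub hN1]; simp
      have hcN' : (N : ℝ) ≤ c0 := by exact_mod_cast hcN
      split_ifs with h0
      · rw [h40, hMR, hN']; linarith
      · rw [hN', Nat.cast_zero, zero_div]; linarith
    · have hN' : ((N - 1 : ℕ) : ℝ) = (N : ℝ) - 1 := by rw [Nat.cast_sub hN1]; simp
      split_ifs with h4
      · have h4N' : 4 * N = lo := by omega
        rw [div_self (by rw [hMR]; norm_num), hN']
        have : (4 : ℝ) * N = lo := by exact_mod_cast h4N'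
        linarith
      · rw [hmend (N - 1) (by omega), hMR, hN', le_div_iff₀ (by norm_num)]
        nlinarith

/-- The walk range of a cell `c < ⌈lo/4⌉` is nonempty. -/
theorem mstart_lt_mend {lo c : ℕ} (hc : c < (lo + 3) / 4) :
    (if c = 0 then MR / 40 else 0) < (if 4 * c + 4 ≤ lo then MR else MR * (lo - 4 * c) / 4) := by
  split_ifs <;> norm_num [MR] <;> omega

/-- The walk range of a cell ends at most at `M`. -/
theorem mend_le {lo c : ℕ} : (if 4 * c + 4 ≤ lo then MR else MR * (lo - 4 * c) / 4) ≤ MR := by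
  split_ifs <;> norm_num [MR]; omega

/-- The size check is monotone in the atom. -/
theorem size_mono {c N W : ℕ} (hc : c ≤ N) (h : (32 * (2000 * N + 1000) * W + 7000) * 225 ≤ SCL * 500) :
    (32 * (2000 * c + 1000) * W + 7000) * 225 ≤ SCL * 500 := by
  have : 2000 * c + 1000 ≤ 2000 * N + 1000 := by clear h; omega
  refine le_trans ?_ h
  gcongr

/-- **SOUNDNESS OF THE DUAL CHECKER**: the light test, the heavy test on the cells `0 … ⌈lo/4⌉−1`, the `225U ≤ 1` size
check, the log table, the u-table and the `ζ(2,¼)` bracket give a dual certificate for `[1/10, lo]`. -/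
theorem dualCert_of_check {n lo D fuel epsN CL CH : ℕ} {logs : List FI} {utab : List (List (ℕ × ℕ))} {pats : List (ℕ × ℕ × ℕ)}
    (hlight : dualLight n lo D logs utab pats epsN CL CH = true)
    (hcheck : dualCheckW n lo D EB fuel 0 ((lo + 3) / 4) logs pats epsN = true)
    (h225 : (32 * (2000 * ((lo + 3) / 4) + 1000) * maxLogWidth logs (n + 1) + 7000) * 225 ≤ SCL * 500)
    (hlogs : ∀ m, 2 ≤ m → m ≤ n + 1 → FI.mem (Real.log m) (logs.getD m (FI.ofInt 0)))
    (hutab : UTabOK utab n) (hCL : (CL : ℝ) ≤ 2 ^ 162 * RungCert.lerchC) (hCH : 2 ^ 162 * RungCert.lerchC ≤ CH) :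
    DualCert n (1 / 10) lo (Zmat n (zMatrix n epsN pats)) := by
  simp only [dualLight, Bool.and_eq_true, decide_eq_true_eq, List.all_eq_true, List.mem_range] at hlight
  obtain ⟨⟨⟨⟨⟨⟨⟨⟨⟨⟨⟨⟨⟨⟨⟨⟨⟨⟨hn1, hn113⟩, hlo⟩, hD4⟩, hWm20⟩, hD2C⟩, hC56⟩, -⟩, -⟩, hul⟩, -⟩, hφ⟩, hsymmc⟩, hZn⟩, hdd⟩,
    hones⟩, hZ62⟩, hcap⟩, hneg⟩ := hlight
  set Z := zMatrix n epsN pats with hZ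
  obtain ⟨hsq, hsymm⟩ := symm_of_check Z hsymmc
  rw [hZn] at hsymm
  have hDD := inDDDual_of_check Z hsq hZn hdd
  have hdiag : ∀ a, a < n → 0 ≤ (Z.getD a []).getD a 0 := fun a ha => by
    have := hDD.1 ⟨a, ha⟩
    simp only [Zmat, Matrix.of_apply] at this
    exact_mod_cast this
  obtain ⟨D', rfl⟩ : ∃ D', D = D' + 1 := ⟨D - 1, by omega⟩
  refine ⟨hDD, fun t ht1 ht2 => ?_, ?_, frob_screw_lt Z utab hsq hZn hsymm hdiag hutab hul hCL hCH hneg⟩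
  · -- the wave atoms
    have ht : 0 < t := by linarith
    have hq : 0 ≤ (constQ Z : ℝ) + qSum Z (fun a => Real.log ((a + 2 : ℕ) : ℝ)) fun μ => Real.cos (t * μ) := by
      obtain ⟨c, hcN, hτ1, hτ2⟩ := cover hlo ht1 ht2
      -- the cell `c` passes
      unfold dualCheckW at hcheck
      simp only [Nat.sub_zero] at hcheck
      obtain ⟨hflag, hcell⟩ := cellsGoW_spec _ _ _ _ _ _ _ _ _ _ _ _ _ _ hcheck c (Nat.zero_le c) (by simpa using hcN)
      have hok := cell_ok (D' := D') (n := n) (c := c) (fuel := fuel) (logs := logs) (Z := Z) rfl rfl rfl hZn hsq hn113 hlogs hD2C hC56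
        (size_mono hcN.le h225) (fun a ha => ⟨(hφ a ha).1, fun b hb => (hφ a ha).2 b hb⟩) hZ62 hcap hflag hcell
        (mstart_lt_mend hcN) mend_le (t / 4 - c) hτ1 hτ2
      simpa only [show (4 * (c : ℝ) + 4 * (t / 4 - c)) = t by ring] using hok
    have hf := frob_waveAtom_eq Z hsq hZn hsymm ht.ne'
    rw [← hf] at hq
    exact nonneg_of_mul_nonneg_right (by rwa [mul_comm] at hq) (by positivity)
  · -- the all-ones atom
    rw [frob_onesMat_eq Z hsq hZn]
    exact_mod_cast hones

/-- **A passing dual check refutes every manifest certificate of `S_{n+1}` with frequencies in `[1/10, lo]`.** -/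
theorem not_manifestCert_of_check {n lo D fuel epsN CL CH : ℕ} {logs : List FI} {utab : List (List (ℕ × ℕ))}
    {pats : List (ℕ × ℕ × ℕ)}
    (hlight : dualLight n lo D logs utab pats epsN CL CH = true)
    (hcheck : dualCheckW n lo D EB fuel 0 ((lo + 3) / 4) logs pats epsN = true)
    (h225 : (32 * (2000 * ((lo + 3) / 4) + 1000) * maxLogWidth logs (n + 1) + 7000) * 225 ≤ SCL * 500)
    (hlogs : ∀ m, 2 ≤ m → m ≤ n + 1 → FI.mem (Real.log m) (logs.getD m (FI.ofInt 0)))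
    (hutab : UTabOK utab n) (hCL : (CL : ℝ) ≤ 2 ^ 162 * RungCert.lerchC) (hCH : 2 ^ 162 * RungCert.lerchC ≤ CH) :
    ¬ ManifestCert n (1 / 10) lo :=
  dualCert_sound (dualCert_of_check hlight hcheck h225 hlogs hutab hCL hCH)

end Summit.RiemannHypothesis.RiemannHypothesis.Theorems.IntegerScrew.Manifest.Fast
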